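import Summits.CriticalPhenomena.PercolationContinuityZ3.Theorems.Transplant.Z3NetFilms
import Summits.CriticalPhenomena.PercolationContinuityZ3.Theorems.Transplant.Z3RungDiluted
import Summits.CriticalPhenomena.PercolationContinuityZ3.Theorems.Transplant.Z3NetTools
import Mathlib.Tactic.FinCases
import HarnessLib

/-!
# Periodic nets on `ℤ³`, VI bis — FILM CUSTOMERS: **every (001)-film `{a ≤ x₂ ≤ b}` of EVERY rung-diluted cubic lattice, and of every TALL Cayley
# graph `Cay(ℤ³; S)` with `(−,−,+)·S ⊆ S`, `(+,−,+)·S ⊆ S`, dies at its own critical point — `θ = 0` at every vertex, every `a, b`**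

builds on p205010 (kernel theorem, internal audit signed; external expert review pending) — through `Z3Net.FlatSym.film_criticalContinuity`
(file `Z3NetFilms`; multi-type D″ node with empty Φ2).
Lane `prim-bschramm`, seat `prim-bschramm-p2` (gen 12; class C1b); helper file (`--supports stmt-CriticalPhenomena-4575 --as helper`).  Memo:
`HOME/bschramm/P2-LATTICES.md` §36 (5).  (Split from `Z3NetFilms` for the 400-line rule.)
* §1 `RungPattern.flatSym`, **`RungPattern.film_criticalContinuity`**, `RungPattern.film_noInfiniteCluster` (a = b: the square lattice `ℤ²`;
  `pcu`: the slabs `ℤ² × {0..k}` of Duminil-Copin–Sidoravicius–Tassion; `striped`: anisotropic films not of the form `ℤ² × G`);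
* §2 `TallGens.flatSym`, **`TallGens.film_criticalContinuity`** (any vertical range; p2-g10's `Z3UnitGensSignSlabCritical` did the unit-range case).
[cite: BenjaminiSchramm1996, Conj. 4 / Question 3] [cite: DuminilCopinSidoraviciusTassion2016, Thm. 1 + p. 3 "Two generalizations"]
[cite: KozmaNitzan2024, §4 p. 16 (Lemma 8)] [cite: GrimmettPercolation1999, §7.2 p. 148 (slabs)]
-/

noncomputable section

namespace Summit.CriticalPhenomena.PercolationContinuityZ3.Theorems.Transplant

open MeasureTheory Literature.Probability.Percolation Literature.Probability.LatticeModels SimpleGraph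
open Z3Diag (ev proj)
open scoped Classical

/-! ## §1 The films of the rung-diluted cubic lattices -/

namespace RungPattern

open Z3Net

variable (P : RungPattern)

/-- **Every rung pattern is flat-symmetric data** (flat, linked, periods `(2,2,n)`, unit range, symmetric under `(−,−,+)` and `(+,−,+)`).
[cite: KozmaNitzan2024, §4 p. 16 (Lemma 8)] -/
def flatSym : P.net.FlatSym where
  flat := P.flat
  linked := P.linked
  n := ![2, 2, P.n]
  n_pos := fun i => by fin_cases i <;> simp [P.n_pos]
  periodic := P.periodic'
  planar := fun x s hs => (P.range x s hs).1
  neg := P.symmetricUnder_of_apply_two _ rfl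
  flip := P.symmetricUnder_of_apply_two _ rfl

/-- **THEOREM (unconditional): every (001)-film `{a ≤ x₂ ≤ b}` of every rung-diluted cubic lattice dies at its own critical point —
`θ_{P.net[film a b]}(v, p_c) = 0` at every vertex, every `a, b`** (for `a = b`: the square lattice `ℤ²`; for `pcu`: DCST's slabs; for `striped`:
anisotropic quasi-transitive films not of the form `ℤ² × G`). builds on p205010 (kernel theorem, internal audit signed; external expert review pending).
[cite: BenjaminiSchramm1996, Conj. 4 / Question 3] [cite: DuminilCopinSidoraviciusTassion2016, Thm. 1 + p. 3] -/
theorem film_criticalContinuity (a b : ℤ) (v : film a b) :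
    theta (P.net.graph.induce (film a b)) v (criticalProbIOf (P.net.graph.induce (film a b)) v) = 0 :=
  P.flatSym.film_criticalContinuity a b v

/-- … with almost surely no infinite cluster in the film at its own critical point. [cite: DuminilCopinSidoraviciusTassion2016, Thm. 1] -/
theorem film_noInfiniteCluster (a b : ℤ) (t : film a b) :
    (bondPercolation (P.net.graph.induce (film a b)) (criticalProbIOf (P.net.graph.induce (film a b)) t)).real
      {ω | ∃ y : film a b, ω ∈ percolatesAt y} = 0 :=
  P.flatSym.film_noInfiniteCluster a b t

end RungPattern

/-! ## §2 The films of the tall Cayley graphs -/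

namespace TallGens

open Z3Net

variable (T : TallGens)

/-- **Flat-symmetric data of a tall Cayley graph** from the two sign vectors `(−,−,+)` (half-turn about `e₂`) and `(+,−,+)` (the flip of `x₁`)
preserving `S`. [cite: KozmaNitzan2024, §4 p. 16 (Lemma 8)] -/
def flatSym (hT : ∀ s ∈ T.S, Z3Net.sgn ![-1, -1, 1] s ∈ T.S) (hY : ∀ s ∈ T.S, Z3Net.sgn ![1, -1, 1] s ∈ T.S) : T.toZ3Net.FlatSym where
  flat := T.toZ3Net_flat
  linked := T.toZ3Net_linked
  n := ![1, 1, 1]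
  n_pos := fun i => by fin_cases i <;> simp
  periodic := Z3Net.ofGens_periodic _ _ _ _
  planar := fun _ s hs => T.planar s hs
  neg := (Z3Net.ofGens_symmetricUnder_iff _ _ _ _).2 hT
  flip := (Z3Net.ofGens_symmetricUnder_iff _ _ _ _).2 hY

/-- **THEOREM: every (001)-film `{a ≤ x₂ ≤ b}` of a tall Cayley graph `Cay(ℤ³; S)` with `(−,−,+)·S ⊆ S` and `(+,−,+)·S ⊆ S` has `θ = 0` at its own
critical point, at every vertex** (arbitrary vertical range: the film cuts the long bonds; p2-g10 typed the unit-range case). builds on p205010 (kernel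
theorem, internal audit signed; external expert review pending). [cite: BenjaminiSchramm1996, Conj. 4 / Question 3] [cite: DuminilCopinSidoraviciusTassion2016, Thm. 1] -/
theorem film_criticalContinuity (hT : ∀ s ∈ T.S, Z3Net.sgn ![-1, -1, 1] s ∈ T.S) (hY : ∀ s ∈ T.S, Z3Net.sgn ![1, -1, 1] s ∈ T.S)
    (a b : ℤ) (v : film a b) : theta (T.graph.induce (film a b)) v (criticalProbIOf (T.graph.induce (film a b)) v) = 0 := by
  have h := (T.flatSym hT hY).film_criticalContinuity a b v
  rwa [toZ3Net_graph] at h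

end TallGens

end Summit.CriticalPhenomena.PercolationContinuityZ3.Theorems.Transplant

end
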